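import Summits.ValiantsHypothesis.ValiantsHypothesis.Theorems.FifoMatchingNNDivisionHardConePricingBalancedFaceZones

/-!
# CONE PRICING on the zonotope chapter of COR-VIRTUAL (crux `NNDivisionHard`, stmt-ValiantsHypothesis-21181) — part 5/5 — §14 (C4) THE BALANCED FACE: val-idea-41's SIZE-MATCHED `Z_cor` is NOT budgeted; §14b the certificate

Theorems-side port (val-port-1 g3, presser; declaration texts VERBATIM, one-line docstrings added where the gate lint wants them) of val-idea-44
g0's author-staged transplant `FifoMatchingNNDivisionHardConePricing.lean` (sha16 51fc894432d3ede5) of the crux workfile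
`Cruxes/NNDivisionHard/ConePricing44.lean` rev 10 @0a2b2fead3a1 (W5-R2; critic of record val-idea-crit-9 g1: WAVE-5 LIST row (6) KEEP §G(3)+(4),
ADDENDUM A4 SIG-FIRST GO 2026-08-28T22:04:39Z), split by the 400-line cap into five modules: `…ConePricing` (§2–§8) → `…Antitone` (§9–§11, §13)
→ `…Corona` (§12); `…ConePricing` → `…BalancedFaceZones` (§14, zones) → `…BalancedFace` (§14 theorem, §14b).  Statement-free (δ-unfolded `Prop`s).

* §14 (second half) `zone_value`, `zone_le` (every zone priced `≤ 0`, tight exactly on `A ⊆ R, B ⊆ Rᶜ`), `rootSet`, `selected_mem_zCorSM`, `slack_selected`,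
  `zCorSM_three_pow_le : 2n+3 ≤ h → HasEFOfSize (zCorSM h) r → 3^n ≤ (r+1)·2^n`.
* §14b `zCorFam`, `balancedFace_three_pow_le` — the reusable certificate («balanced-face clique exposure») for any corona zone family of
  disjoint size-matched pairs with one saturated block pair.

HONEST LABEL: helper rows for an OPEN crux (21181 `NNDivisionHard` OPEN; COR-VIRTUAL / `CovZonoHard` OPEN); nothing here is a summit
statement; VP ≠ VNP is NOT proved.
-/

set_option autoImplicit false
-- the mandated summit-side namespace repeats a component by design (single-problem summit)
set_option linter.dupNamespace false

noncomputable section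
open Matrix Finset
open scoped Pointwise

namespace Summit.ValiantsHypothesis.ValiantsHypothesis.Theorems.FifoMatching

namespace ConePricing

open Literature.Barriers.PneNP (HasEFOfSize)
open Literature.Combinatorics.Optimization (corPolytopeGraph corVec)

variable {h : ℕ}

/-- the augmented functional `c_a = −(u_a^R)(u_a^R)ᵀ + λ·W_R` evaluated on a zone. -/
theorem zone_value (n h : ℕ) (hm : n + 1 ≤ h) (a : Finset (Fin n)) (lam : ℝ) (A B : Finset (Fin h)) (hAB : Disjoint A B) :
    ((fun x : Fin h × Fin h => -(uPush (rhoR n h hm) a x.1 * uPush (rhoR n h hm) a x.2)) + lam • wR h (n + 1)) ⬝ᵥ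
        coronaKernel A B
      = -((∑ p ∈ A, uPush (rhoR n h hm) a p) + ∑ p ∈ B, uPush (rhoR n h hm) a p) ^ 2
          + (∑ p ∈ B, uPush (rhoR n h hm) a p) ^ 2
          + lam * ((-2 * (cR (n + 1) A + cR (n + 1) B) ^ 2 + 2 * (cR (n + 1) A + cR (n + 1) B) * (cS (n + 1) A + cS (n + 1) B)
                      - (6 * ((n : ℝ) + 1) + 1) * (cS (n + 1) A + cS (n + 1) B))
                    - (-2 * cR (n + 1) B ^ 2 + 2 * cR (n + 1) B * cS (n + 1) B - (6 * ((n : ℝ) + 1) + 1) * cS (n + 1) B)) := by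
  rw [add_dotProduct, smul_dotProduct, smul_eq_mul, negRankOne_dot_coronaKernel, dot_coronaKernel, qf_wR, qf_wR,
    Finset.sum_union hAB, cR_union _ hAB, cS_union _ hAB]
  push_cast
  ring

/-- ★ every zone of `Z_cor` is priced nonpositively by `c_a` (`λ = (h(n+1))²`). -/
theorem zone_le (n h : ℕ) (hm : n + 1 ≤ h) (a : Finset (Fin n)) (A B : Finset (Fin h)) (hAB : Disjoint A B)
    (hcard : A.card = B.card) :
    ((fun x : Fin h × Fin h => -(uPush (rhoR n h hm) a x.1 * uPush (rhoR n h hm) a x.2))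
        + (((h : ℝ) * ((n : ℝ) + 1)) ^ 2) • wR h (n + 1)) ⬝ᵥ coronaKernel A B ≤ 0 := by
  classical
  rw [zone_value n h hm a _ A B hAB]
  have hsz : cR (n + 1) A + cS (n + 1) A = cR (n + 1) B + cS (n + 1) B := by
    rw [cR_add_cS, cR_add_cS]; exact_mod_cast hcard
  have haS : 0 ≤ cS (n + 1) A := Nat.cast_nonneg _
  have haR0 : 0 ≤ cR (n + 1) A := Nat.cast_nonneg _
  have hbR0 : 0 ≤ cR (n + 1) B := Nat.cast_nonneg _
  have haR : cR (n + 1) A ≤ (n : ℝ) + 1 := by exact_mod_cast cR_le (n + 1) A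
  have hbR : cR (n + 1) B ≤ (n : ℝ) + 1 := by exact_mod_cast cR_le (n + 1) B
  have hf := face_ineq_aux ((n : ℝ) + 1) (cR (n + 1) A) (cS (n + 1) A) (cR (n + 1) B) (cS (n + 1) B) haS hsz haR hbR
  set lam : ℝ := ((h : ℝ) * ((n : ℝ) + 1)) ^ 2 with hlam_def
  have hlam : 0 ≤ lam := sq_nonneg _
  set UA := ∑ p ∈ A, uPush (rhoR n h hm) a p with hUA_def
  set UB := ∑ p ∈ B, uPush (rhoR n h hm) a p with hUB_def
  set f := (-2 * (cR (n + 1) A + cR (n + 1) B) ^ 2 + 2 * (cR (n + 1) A + cR (n + 1) B) * (cS (n + 1) A + cS (n + 1) B)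
              - (6 * ((n : ℝ) + 1) + 1) * (cS (n + 1) A + cS (n + 1) B))
            - (-2 * cR (n + 1) B ^ 2 + 2 * cR (n + 1) B * cS (n + 1) B - (6 * ((n : ℝ) + 1) + 1) * cS (n + 1) B) with hf_def
  have hlf : lam * f ≤ lam * (-cS (n + 1) A - 6 * (cR (n + 1) A * cR (n + 1) B)) := mul_le_mul_of_nonneg_left hf hlam
  have hlf0 : lam * f ≤ 0 :=
    hlf.trans (by nlinarith [mul_nonneg hlam haS, mul_nonneg hlam (mul_nonneg haR0 hbR0)])
  have hUBsq : UB ^ 2 ≤ lam := by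
    have hb := abs_sumU_le (rhoR n h hm) a B
    rw [hlam_def, ← sq_abs UB]
    exact pow_le_pow_left₀ (abs_nonneg _) hb 2
  by_cases hb0 : cR (n + 1) B = 0
  · have hUB0 : UB = 0 := sumU_offblock n h hm a B (offblock_of_cR_eq_zero n B hb0)
    rw [hUB0]
    nlinarith [sq_nonneg UA]
  · by_cases ha0 : cR (n + 1) A = 0
    · have hUA0 : UA = 0 := sumU_offblock n h hm a A (offblock_of_cR_eq_zero n A ha0)
      rw [hUA0]
      nlinarith
    · have ha1 : 1 ≤ cR (n + 1) A := by
        have : (A.filter fun p : Fin h => (p : ℕ) < n + 1).card ≠ 0 := by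
          intro h0; apply ha0; unfold cR; exact_mod_cast h0
        unfold cR; exact_mod_cast Nat.one_le_iff_ne_zero.mpr this
      have hb1 : 1 ≤ cR (n + 1) B := by
        have : (B.filter fun p : Fin h => (p : ℕ) < n + 1).card ≠ 0 := by
          intro h0; apply hb0; unfold cR; exact_mod_cast h0
        unfold cR; exact_mod_cast Nat.one_le_iff_ne_zero.mpr this
      have hab1 : 1 ≤ cR (n + 1) A * cR (n + 1) B := by nlinarith
      nlinarith [sq_nonneg (UA + UB), mul_nonneg hlam (sub_nonneg.2 hab1), mul_nonneg hlam haS]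

/-- the rooted pattern set `{0} ∪ succ(b) ⊆ Fin (n+1)`. -/
def rootSet {n : ℕ} (b : Finset (Fin n)) : Finset (Fin (n + 1)) :=
  Finset.univ.filter fun i => (Fin.cons true (fun j => decide (j ∈ b)) : Fin (n + 1) → Bool) i = true

/-- the root `0` belongs to `rootSet b`. -/
theorem zero_mem_rootSet {n : ℕ} (b : Finset (Fin n)) : (0 : Fin (n + 1)) ∈ rootSet b := by
  simp [rootSet]

/-- the selected zone for the pattern `b`: `A_b = ρ(rootSet b) ⊆ R`, `B_b = ρ'(rootSet b) ⊆ Rᶜ` (same size). -/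
theorem smAdm_selected (n h : ℕ) (hh : 2 * n + 3 ≤ h) (b : Finset (Fin n)) :
    Disjoint ((rootSet b).map (rhoR n h (by omega))) ((rootSet b).map (rhoR' n h (by omega))) ∧
      ((rootSet b).map (rhoR n h (by omega))).card = ((rootSet b).map (rhoR' n h (by omega))).card ∧ 1 ≤ ((rootSet b).map (rhoR n h (by omega))).card ∧
      ((rootSet b).map (rhoR n h (by omega))) ∪ ((rootSet b).map (rhoR' n h (by omega))) ≠ Finset.univ := by
  classical
  refine ⟨?_, ?_, ?_, ?_⟩
  · rw [Finset.disjoint_left]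
    intro p hpA hpB
    obtain ⟨i, -, rfl⟩ := Finset.mem_map.mp hpA
    obtain ⟨j, -, hj⟩ := Finset.mem_map.mp hpB
    have := congrArg Fin.val hj
    simp only [rhoR'_val, rhoR_val] at this
    omega
  · rw [Finset.card_map, Finset.card_map]
  · rw [Finset.card_map]
    exact Finset.card_pos.mpr ⟨0, zero_mem_rootSet b⟩
  · intro hU
    have hlast : (⟨h - 1, by omega⟩ : Fin h) ∈ (rootSet b).map (rhoR n h (by omega)) ∪ (rootSet b).map (rhoR' n h (by omega)) := by
      rw [hU]; exact Finset.mem_univ _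
    rcases Finset.mem_union.mp hlast with hA | hB
    · obtain ⟨i, -, hi⟩ := Finset.mem_map.mp hA
      have := congrArg Fin.val hi
      simp only [rhoR_val] at this
      omega
    · obtain ⟨i, -, hi⟩ := Finset.mem_map.mp hB
      have := congrArg Fin.val hi
      simp only [rhoR'_val] at this
      omega

/-- the corona kernel of the selected pair `(ρ(rootSet b), ρ'(rootSet b))` is a generator of `zCorSM h`. -/
theorem selected_mem_zCorSM (n h : ℕ) (hh : 2 * n + 3 ≤ h) (b : Finset (Fin n)) :
    coronaKernel ((rootSet b).map (rhoR n h (by omega))) ((rootSet b).map (rhoR' n h (by omega))) ∈ zCorSM h := by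
  classical
  set A := (rootSet b).map (rhoR n h (by omega))
  set B := (rootSet b).map (rhoR' n h (by omega))
  refine ⟨fun AB => if AB = (A, B) then 1 else 0, fun AB => by simp only; split_ifs <;> norm_num, fun AB hAB => ?_, ?_⟩
  · simp only
    rw [if_neg]
    rintro rfl
    exact hAB (smAdm_selected n h hh b)
  · simp [ite_smul, Finset.sum_ite_eq']

/-- the slack of `c_a` at the selected zone `v_b`: `−(|a ∩ b| − 1)²` (the UDISJ pattern). -/
theorem slack_selected (n h : ℕ) (hh : 2 * n + 3 ≤ h) (a b : Finset (Fin n)) :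
    ((fun x : Fin h × Fin h => -(uPush (rhoR n h (by omega)) a x.1 * uPush (rhoR n h (by omega)) a x.2))
        + (((h : ℝ) * ((n : ℝ) + 1)) ^ 2) • wR h (n + 1)) ⬝ᵥ
        coronaKernel ((rootSet b).map (rhoR n h (by omega))) ((rootSet b).map (rhoR' n h (by omega)))
      = -((((a ∩ b).card : ℝ) - 1) ^ 2) := by
  classical
  have hm : n + 1 ≤ h := by omega
  have hh' : 2 * n + 2 ≤ h := by omega
  have hAB := (smAdm_selected n h hh b).1
  rw [zone_value n h hm a _ _ _ hAB]
  -- the `B`-block sum vanishes, the `A`-block sum is the BFPS pairing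
  have hB0 : ∑ p ∈ (rootSet b).map (rhoR' n h hh'), uPush (rhoR n h hm) a p = 0 := by
    refine sumU_offblock n h hm a _ fun p hp => ?_
    obtain ⟨i, -, rfl⟩ := Finset.mem_map.mp hp
    simp only [rhoR'_val]; omega
  have hA : ∑ p ∈ (rootSet b).map (rhoR n h hm), uPush (rhoR n h hm) a p = ((a ∩ b).card : ℝ) - 1 := by
    rw [Finset.sum_map]
    have : ∀ i ∈ rootSet b, uPush (rhoR n h hm) a ((rhoR n h hm) i) = uVec a i := fun i _ => uPush_rhoR_at n h hm a i
    rw [Finset.sum_congr rfl this, rootSet, Finset.sum_filter, ← sum_uVec_chi a b]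
    refine Finset.sum_congr rfl fun i _ => ?_
    simp only [chi]
    split_ifs <;> simp
  -- block counts of the selected zone: `A ⊆ R`, `B ⊆ Rᶜ`, `|A| = |B|`
  have hcRA : cR (n + 1) ((rootSet b).map (rhoR n h hm)) = (rootSet b).card := by
    unfold cR
    rw [Finset.filter_true_of_mem, Finset.card_map]
    intro p hp
    obtain ⟨i, -, rfl⟩ := Finset.mem_map.mp hp
    simp only [rhoR_val]; exact i.isLt
  have hcSA : cS (n + 1) ((rootSet b).map (rhoR n h hm)) = 0 := by
    unfold cS
    rw [Finset.filter_false_of_mem]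
    · simp
    intro p hp
    obtain ⟨i, -, rfl⟩ := Finset.mem_map.mp hp
    simp only [rhoR_val, not_not]; exact i.isLt
  have hcRB : cR (n + 1) ((rootSet b).map (rhoR' n h hh')) = 0 := by
    unfold cR
    rw [Finset.filter_false_of_mem]
    · simp
    intro p hp
    obtain ⟨i, -, rfl⟩ := Finset.mem_map.mp hp
    simp only [rhoR'_val]; omega
  have hcSB : cS (n + 1) ((rootSet b).map (rhoR' n h hh')) = (rootSet b).card := by
    unfold cS
    rw [Finset.filter_true_of_mem, Finset.card_map]
    intro p hp
    obtain ⟨i, -, rfl⟩ := Finset.mem_map.mp hp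
    simp only [rhoR'_val]; omega
  rw [hB0, hA, hcRA, hcSA, hcRB, hcSB]
  ring

/-- ★★ (C4) PROVED: `xc(Z_cor(h)) ≥ 1.5^n − 1` whenever `2n + 3 ≤ h` — 41's canonical size-matched corona zonotope is NOT budgeted. -/
theorem zCorSM_three_pow_le (n h r : ℕ) (hh : 2 * n + 3 ≤ h) (hEF : HasEFOfSize (zCorSM h) r) :
    3 ^ n ≤ (r + 1) * 2 ^ n := by
  classical
  refine hEF.three_pow_le
    (fun b => coronaKernel ((rootSet b).map (rhoR n h (by omega))) ((rootSet b).map (rhoR' n h (by omega))))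
    (fun b => selected_mem_zCorSM n h hh b)
    (fun a => (fun x : Fin h × Fin h => -(uPush (rhoR n h (by omega)) a x.1 * uPush (rhoR n h (by omega)) a x.2))
        + (((h : ℝ) * ((n : ℝ) + 1)) ^ 2) • wR h (n + 1))
    (fun _ => 0) ?_ ?_ ?_
  · -- validity on the whole zonotope: every zone is priced nonpositively, coefficients are nonnegative
    rintro a x ⟨μ, hμ, hμ0, rfl⟩
    rw [dotProduct_sum]
    refine Finset.sum_nonpos fun AB _ => ?_
    rw [dotProduct_smul, smul_eq_mul]
    by_cases hadm : (Disjoint AB.1 AB.2 ∧ AB.1.card = AB.2.card ∧ 1 ≤ AB.1.card ∧ AB.1 ∪ AB.2 ≠ Finset.univ)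
    · exact mul_nonpos_of_nonneg_of_nonpos (hμ AB).1 (zone_le n h (by omega) a AB.1 AB.2 hadm.1 hadm.2.1)
    · rw [hμ0 AB hadm, zero_mul]
  · intro a b hlt hcard
    rw [slack_selected n h hh a b, hcard] at hlt
    norm_num at hlt
  · intro a b hab
    rw [slack_selected n h hh a b, Finset.disjoint_iff_inter_eq_empty.mp hab]
    norm_num


/-! ### 14b. The certificate in general form: «BALANCED-FACE CLIQUE EXPOSURE».  Any corona zonotope `Σ_{(A,B) ∈ F} [0,1]·g_{A,B}` whose zone
family `F` consists of disjoint size-matched pairs and CONTAINS the selected pairs `(ρ(S), ρ′(S))` (`S ∋ 0` a rooted subset of the block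
`R = {p < n+1}`, `ρ′` the partner block) obeys `3^n ≤ (xc+1)·2^n`.  (`zCorSM` is the case of ALL size-matched admissible pairs; thinning `Z_cor` does not help as long
as one block pair stays saturated.) -/

/-- a corona zonotope on an arbitrary zone family `F`. -/
def zCorFam (h : ℕ) (F : Finset (Fin h) → Finset (Fin h) → Prop) : Set (Fin h × Fin h → ℝ) :=
  {x | ∃ μ : Finset (Fin h) × Finset (Fin h) → ℝ, (∀ AB, 0 ≤ μ AB ∧ μ AB ≤ 1) ∧ (∀ AB, ¬ F AB.1 AB.2 → μ AB = 0) ∧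
    x = ∑ AB, μ AB • coronaKernel AB.1 AB.2}

/-- ★ BALANCED-FACE CLIQUE EXPOSURE (general certificate, PROVED). -/
theorem balancedFace_three_pow_le (n h r : ℕ) (hh : 2 * n + 3 ≤ h) (F : Finset (Fin h) → Finset (Fin h) → Prop)
    (hF : ∀ A B, F A B → Disjoint A B ∧ A.card = B.card)
    (hsel : ∀ b : Finset (Fin n), F ((rootSet b).map (rhoR n h (by omega))) ((rootSet b).map (rhoR' n h (by omega))))
    (hEF : HasEFOfSize (zCorFam h F) r) : 3 ^ n ≤ (r + 1) * 2 ^ n := by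
  classical
  refine hEF.three_pow_le
    (fun b => coronaKernel ((rootSet b).map (rhoR n h (by omega))) ((rootSet b).map (rhoR' n h (by omega))))
    (fun b => ?_)
    (fun a => (fun x : Fin h × Fin h => -(uPush (rhoR n h (by omega)) a x.1 * uPush (rhoR n h (by omega)) a x.2))
        + (((h : ℝ) * ((n : ℝ) + 1)) ^ 2) • wR h (n + 1))
    (fun _ => 0) ?_ ?_ ?_
  · -- the selected zones lie in the zonotope
    refine ⟨fun AB => if AB = ((rootSet b).map (rhoR n h (by omega)), (rootSet b).map (rhoR' n h (by omega))) then 1 else 0,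
      fun AB => by simp only; split_ifs <;> norm_num, fun AB hAB => ?_, ?_⟩
    · simp only
      rw [if_neg]
      rintro rfl
      exact hAB (hsel b)
    · simp [ite_smul, Finset.sum_ite_eq']
  · rintro a x ⟨μ, hμ, hμ0, rfl⟩
    rw [dotProduct_sum]
    refine Finset.sum_nonpos fun AB _ => ?_
    rw [dotProduct_smul, smul_eq_mul]
    by_cases hadm : F AB.1 AB.2
    · exact mul_nonpos_of_nonneg_of_nonpos (hμ AB).1 (zone_le n h (by omega) a AB.1 AB.2 (hF _ _ hadm).1 (hF _ _ hadm).2)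
    · rw [hμ0 AB hadm, zero_mul]
  · intro a b hlt hcard
    rw [slack_selected n h hh a b, hcard] at hlt
    norm_num at hlt
  · intro a b hab
    rw [slack_selected n h hh a b, Finset.disjoint_iff_inter_eq_empty.mp hab]
    norm_num

end ConePricing

end Summit.ValiantsHypothesis.ValiantsHypothesis.Theorems.FifoMatching

end
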